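import Literature.MathematicalPhysics.QuantumManyBody.BoseGasWallCutoff
import Mathlib.Analysis.SpecialFunctions.Integrals.Basic
import HarnessLib

/-!
# A `C¹` flat-top profile on `[0, 1]` with mass `11/16` and kinetic constant `π²`

Topic `Literature/MathematicalPhysics/QuantumManyBody` (grouping namespace `BoseGas`). The
one-dimensional building block of an explicit one-particle Dirichlet orbital of a box whose
density is FLAT in the bulk (`BoseGasProductOrbital.lean`; insertion of one particle into an
`N`-body state with explicit constants, crux `RigidMomentumBound` of
`AtomisticToContinuum/BoseEinsteinCondensation`). With the cosine wall profile of
`BoseGasWallCutoff.lean`: the ramp `r(t) = (1 - cos(π · max 0 (min 1 (4t))))/2` (`0` on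
`(-∞,0]`, `1` on `[1/4,∞)`, `C¹`, slope `r'`), the flat-top profile `p(t) = r(t) r(1-t)`
(`C¹`, values in `[0,1]`, `= 1` on `[1/4,3/4]`, `= 0` off `(0,1)`, derivative
`p' = r'(t)r(1-t) - r(t)r'(1-t)`), and the constants `∫_ℝ p² = 11/16`, `∫_ℝ p'² = π²` (from
`∫₀^{1/4} ((1-cos 4πt)/2)² = 3/32`, `∫₀^{1/4} (2π sin 4πt)² = π²/2` by explicit antiderivatives,
and the reflection `t ↦ 1-t`); packaged as `exists_flatTopProfile`. No definitions: `r, r', p, p'`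
are section variables characterised by their closed forms. Elementary calculus, tagged folklore.
-/

noncomputable section

namespace Literature.MathematicalPhysics.QuantumManyBody.BoseGas

open _root_.MeasureTheory _root_.Filter _root_.Set _root_.Real intervalIntegral
open scoped ENNReal NNReal Topology

namespace FlatTop

/-! ### Two trigonometric integrals over the ramp -/

/-- `cos 8πt = 2cos²(4πt) - 1`. [folklore] -/
theorem cos_eight_pi_mul (t : ℝ) : cos (8 * π * t) = 2 * cos (4 * π * t) ^ 2 - 1 := by
  rw [show (8 : ℝ) * π * t = 2 * (4 * π * t) by ring]
  exact cos_two_mul _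

/-- `∫₀^{1/4} ((1 - cos 4πt)/2)² dt = 3/32`
(antiderivative `3t/8 - sin 4πt/(8π) + sin 8πt/(64π)`). [folklore] -/
theorem integral_rampSq :
    ∫ t in (0 : ℝ)..(1 / 4), ((1 - cos (4 * π * t)) / 2) ^ 2 = 3 / 32 := by
  have hderiv : ∀ t ∈ uIcc (0 : ℝ) (1 / 4), HasDerivAt
      (fun t => 3 * t / 8 - sin (4 * π * t) / (8 * π) + sin (8 * π * t) / (64 * π))
      (((1 - cos (4 * π * t)) / 2) ^ 2) t := by
    intro t _
    have hA : HasDerivAt (fun t : ℝ => 3 * t / 8) (3 * 1 / 8) t :=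
      ((hasDerivAt_id' t).const_mul 3).div_const 8
    have hB : HasDerivAt (fun t : ℝ => sin (4 * π * t) / (8 * π))
        (cos (4 * π * t) * (4 * π * 1) / (8 * π)) t :=
      ((hasDerivAt_id' t).const_mul (4 * π)).sin.div_const (8 * π)
    have hC : HasDerivAt (fun t : ℝ => sin (8 * π * t) / (64 * π))
        (cos (8 * π * t) * (8 * π * 1) / (64 * π)) t :=
      ((hasDerivAt_id' t).const_mul (8 * π)).sin.div_const (64 * π)
    refine ((hA.sub hB).add hC).congr_deriv ?_
    rw [cos_eight_pi_mul]
    field_simp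
    ring
  rw [integral_eq_sub_of_hasDerivAt hderiv ((by fun_prop : Continuous fun t : ℝ =>
    ((1 - cos (4 * π * t)) / 2) ^ 2).intervalIntegrable _ _)]
  have e1 : 4 * π * (1 / 4) = π := by ring
  have e2 : 8 * π * (1 / 4) = 2 * π := by ring
  simp only [e1, e2, sin_pi, sin_two_pi, mul_zero, sin_zero, zero_div, sub_zero, add_zero]
  norm_num

/-- `∫₀^{1/4} (2π sin 4πt)² dt = π²/2` (antiderivative `2π²t - π sin 8πt/4`). [folklore] -/
theorem integral_rampDerivSq :
    ∫ t in (0 : ℝ)..(1 / 4), (2 * π * sin (4 * π * t)) ^ 2 = π ^ 2 / 2 := by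
  have hderiv : ∀ t ∈ uIcc (0 : ℝ) (1 / 4), HasDerivAt
      (fun t => 2 * π ^ 2 * t - π * sin (8 * π * t) / 4) ((2 * π * sin (4 * π * t)) ^ 2) t := by
    intro t _
    have hA : HasDerivAt (fun t : ℝ => 2 * π ^ 2 * t) (2 * π ^ 2 * 1) t :=
      (hasDerivAt_id' t).const_mul (2 * π ^ 2)
    have hC : HasDerivAt (fun t : ℝ => π * sin (8 * π * t) / 4)
        (π * (cos (8 * π * t) * (8 * π * 1)) / 4) t :=
      (((hasDerivAt_id' t).const_mul (8 * π)).sin.const_mul π).div_const 4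
    refine (hA.sub hC).congr_deriv ?_
    rw [cos_eight_pi_mul, cos_sq']
    ring
  rw [integral_eq_sub_of_hasDerivAt hderiv ((by fun_prop : Continuous fun t : ℝ =>
    (2 * π * sin (4 * π * t)) ^ 2).intervalIntegrable _ _)]
  have e2 : 8 * π * (1 / 4) = 2 * π := by ring
  simp only [e2, sin_two_pi, mul_zero, sin_zero, zero_div, sub_zero]
  ring

section Profile

variable {r r' p p' : ℝ → ℝ}

/-! ### The ramp of width `1/4` -/

/-- `0 < 1/4`. [folklore] -/
theorem quarter_pos : (0 : ℝ) < 1 / 4 := by norm_num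

/-- `r'` is the derivative of the ramp `r` (one minus the wall profile). [folklore] -/
theorem hasDerivAt_ramp (hr : ∀ t, r t = 1 - (1 + cos (π * max 0 (min 1 ((t - 0) / (1 / 4))))) / 2)
    (hr' : ∀ t, r' t = -(-(π / (1 / 4)) * sin (π * max 0 (min 1 ((t - 0) / (1 / 4)))) / 2))
    (t : ℝ) : HasDerivAt r (r' t) t := by
  rw [show r = _ from funext hr, hr']
  exact (WallCutoff.hasDerivAt_wallProfile (a := 0) quarter_pos t).const_sub 1

/-- The ramp is `C¹`. [folklore] -/
theorem contDiff_ramp (hr : ∀ t, r t = 1 - (1 + cos (π * max 0 (min 1 ((t - 0) / (1 / 4))))) / 2) :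
    ContDiff ℝ 1 r := by
  rw [show r = _ from funext hr]
  exact contDiff_const.sub (WallCutoff.contDiff_wallProfile (a := 0) quarter_pos)

/-- The slope of the ramp is continuous. [folklore] -/
theorem continuous_rampD
    (hr' : ∀ t, r' t = -(-(π / (1 / 4)) * sin (π * max 0 (min 1 ((t - 0) / (1 / 4)))) / 2)) :
    Continuous r' := by
  rw [show r' = _ from funext hr']
  exact (WallCutoff.continuous_wallProfileDeriv 0 (1 / 4)).neg

/-- The ramp vanishes on `(-∞, 0]`. [folklore] -/
theorem ramp_of_nonpos (hr : ∀ t, r t = 1 - (1 + cos (π * max 0 (min 1 ((t - 0) / (1 / 4))))) / 2)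
    {t : ℝ} (ht : t ≤ 0) : r t = 0 := by
  rw [hr, WallCutoff.wallProfile_of_le quarter_pos ht]; norm_num

/-- The ramp is `1` on `[1/4, ∞)`. [folklore] -/
theorem ramp_of_ge (hr : ∀ t, r t = 1 - (1 + cos (π * max 0 (min 1 ((t - 0) / (1 / 4))))) / 2)
    {t : ℝ} (ht : 1 / 4 ≤ t) : r t = 1 := by
  rw [hr, WallCutoff.wallProfile_of_ge (a := 0) quarter_pos (by linarith)]; norm_num

/-- The slope vanishes on `(-∞, 0]`. [folklore] -/
theorem rampD_of_nonpos
    (hr' : ∀ t, r' t = -(-(π / (1 / 4)) * sin (π * max 0 (min 1 ((t - 0) / (1 / 4)))) / 2))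
    {t : ℝ} (ht : t ≤ 0) : r' t = 0 := by
  rw [hr', WallCutoff.wallProfileDeriv_of_le quarter_pos ht, neg_zero]

/-- The slope vanishes on `[1/4, ∞)`. [folklore] -/
theorem rampD_of_ge
    (hr' : ∀ t, r' t = -(-(π / (1 / 4)) * sin (π * max 0 (min 1 ((t - 0) / (1 / 4)))) / 2))
    {t : ℝ} (ht : 1 / 4 ≤ t) : r' t = 0 := by
  rw [hr', WallCutoff.wallProfileDeriv_of_ge (a := 0) quarter_pos (by linarith), neg_zero]

/-- `0 ≤ r ≤ 1`. [folklore] -/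
theorem ramp_mem (hr : ∀ t, r t = 1 - (1 + cos (π * max 0 (min 1 ((t - 0) / (1 / 4))))) / 2)
    (t : ℝ) : 0 ≤ r t ∧ r t ≤ 1 := by
  have h := WallCutoff.wallProfile_mem 0 (1 / 4) t
  rw [hr]
  constructor <;> linarith [h.1, h.2]

/-- On `[0, 1/4]`: `r(t) = (1 - cos 4πt)/2`. [folklore] -/
theorem ramp_of_mem (hr : ∀ t, r t = 1 - (1 + cos (π * max 0 (min 1 ((t - 0) / (1 / 4))))) / 2)
    {t : ℝ} (ht : t ∈ Icc (0 : ℝ) (1 / 4)) : r t = (1 - cos (4 * π * t)) / 2 := by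
  rw [hr, WallCutoff.ramp_of_mem (a := 0) quarter_pos (by simpa using ht),
    show π * ((t - 0) / (1 / 4)) = 4 * π * t by ring]
  ring

/-- On `[0, 1/4]`: `r'(t) = 2π sin 4πt`. [folklore] -/
theorem rampD_of_mem
    (hr' : ∀ t, r' t = -(-(π / (1 / 4)) * sin (π * max 0 (min 1 ((t - 0) / (1 / 4)))) / 2))
    {t : ℝ} (ht : t ∈ Icc (0 : ℝ) (1 / 4)) : r' t = 2 * π * sin (4 * π * t) := by
  rw [hr', WallCutoff.ramp_of_mem (a := 0) quarter_pos (by simpa using ht),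
    show π * ((t - 0) / (1 / 4)) = 4 * π * t by ring]
  ring

/-! ### The flat-top profile `p(t) = r(t) r(1 - t)` -/

/-- `p'` is the derivative of `p`. [folklore] -/
theorem hasDerivAt_flatTop
    (hr : ∀ t, r t = 1 - (1 + cos (π * max 0 (min 1 ((t - 0) / (1 / 4))))) / 2)
    (hr' : ∀ t, r' t = -(-(π / (1 / 4)) * sin (π * max 0 (min 1 ((t - 0) / (1 / 4)))) / 2))
    (hp : ∀ t, p t = r t * r (1 - t)) (hp' : ∀ t, p' t = r' t * r (1 - t) - r t * r' (1 - t))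
    (t : ℝ) : HasDerivAt p (p' t) t := by
  have h2 : HasDerivAt (fun s : ℝ => r (1 - s)) (r' (1 - t) * -1) t := by
    have h := (hasDerivAt_ramp hr hr' (1 - t)).comp t ((hasDerivAt_id t).const_sub 1)
    simpa [Function.comp_def] using h
  rw [show p = _ from funext hp, hp']
  exact ((hasDerivAt_ramp hr hr' t).mul h2).congr_deriv (by ring)

/-- `p` is `C¹`. [folklore] -/
theorem contDiff_flatTop
    (hr : ∀ t, r t = 1 - (1 + cos (π * max 0 (min 1 ((t - 0) / (1 / 4))))) / 2)
    (hp : ∀ t, p t = r t * r (1 - t)) : ContDiff ℝ 1 p := by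
  rw [show p = _ from funext hp]
  exact (contDiff_ramp hr).mul ((contDiff_ramp hr).comp (contDiff_const.sub contDiff_id))

/-- `p'` is continuous. [folklore] -/
theorem continuous_flatTopDeriv
    (hr : ∀ t, r t = 1 - (1 + cos (π * max 0 (min 1 ((t - 0) / (1 / 4))))) / 2)
    (hr' : ∀ t, r' t = -(-(π / (1 / 4)) * sin (π * max 0 (min 1 ((t - 0) / (1 / 4)))) / 2))
    (hp' : ∀ t, p' t = r' t * r (1 - t) - r t * r' (1 - t)) : Continuous p' := by
  rw [show p' = _ from funext hp']
  have hc := (contDiff_ramp hr).continuous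
  have hd := continuous_rampD hr'
  exact (hd.mul (hc.comp (continuous_const.sub continuous_id))).sub
    (hc.mul (hd.comp (continuous_const.sub continuous_id)))

/-- `0 ≤ p ≤ 1`. [folklore] -/
theorem flatTop_mem (hr : ∀ t, r t = 1 - (1 + cos (π * max 0 (min 1 ((t - 0) / (1 / 4))))) / 2)
    (hp : ∀ t, p t = r t * r (1 - t)) (t : ℝ) : 0 ≤ p t ∧ p t ≤ 1 := by
  have h1 := ramp_mem hr t
  have h2 := ramp_mem hr (1 - t)
  rw [hp]
  exact ⟨mul_nonneg h1.1 h2.1, mul_le_one₀ h1.2 h2.1 h2.2⟩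

/-- `p` vanishes off `(0, 1)`. [folklore] -/
theorem flatTop_eq_zero_of_not_mem
    (hr : ∀ t, r t = 1 - (1 + cos (π * max 0 (min 1 ((t - 0) / (1 / 4))))) / 2)
    (hp : ∀ t, p t = r t * r (1 - t)) (t : ℝ) (ht : t ∉ Ioo (0 : ℝ) 1) : p t = 0 := by
  rw [mem_Ioo, not_and_or, not_lt, not_lt] at ht
  rw [hp]
  rcases ht with h | h
  · rw [ramp_of_nonpos hr h, zero_mul]
  · rw [ramp_of_nonpos hr (t := 1 - t) (by linarith), mul_zero]

/-- `p'` vanishes off `(0, 1)`. [folklore] -/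
theorem flatTopDeriv_eq_zero_of_not_mem
    (hr : ∀ t, r t = 1 - (1 + cos (π * max 0 (min 1 ((t - 0) / (1 / 4))))) / 2)
    (hr' : ∀ t, r' t = -(-(π / (1 / 4)) * sin (π * max 0 (min 1 ((t - 0) / (1 / 4)))) / 2))
    (hp' : ∀ t, p' t = r' t * r (1 - t) - r t * r' (1 - t)) {t : ℝ} (ht : t ∉ Ioo (0 : ℝ) 1) :
    p' t = 0 := by
  rw [mem_Ioo, not_and_or, not_lt, not_lt] at ht
  rw [hp']
  rcases ht with h | h
  · rw [ramp_of_nonpos hr h, rampD_of_nonpos hr' h]; ring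
  · rw [ramp_of_nonpos hr (t := 1 - t) (by linarith), rampD_of_nonpos hr' (t := 1 - t) (by linarith)]
    ring

/-- On `[0, 1/4]`: `p(t) = (1 - cos 4πt)/2`. [folklore] -/
theorem flatTop_of_mem_left
    (hr : ∀ t, r t = 1 - (1 + cos (π * max 0 (min 1 ((t - 0) / (1 / 4))))) / 2)
    (hp : ∀ t, p t = r t * r (1 - t)) {t : ℝ} (ht : t ∈ Icc (0 : ℝ) (1 / 4)) :
    p t = (1 - cos (4 * π * t)) / 2 := by
  rw [hp, ramp_of_mem hr ht, ramp_of_ge hr (t := 1 - t) (by linarith [ht.2]), mul_one]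

/-- On `[0, 1/4]`: `p'(t) = 2π sin 4πt`. [folklore] -/
theorem flatTopDeriv_of_mem_left
    (hr : ∀ t, r t = 1 - (1 + cos (π * max 0 (min 1 ((t - 0) / (1 / 4))))) / 2)
    (hr' : ∀ t, r' t = -(-(π / (1 / 4)) * sin (π * max 0 (min 1 ((t - 0) / (1 / 4)))) / 2))
    (hp' : ∀ t, p' t = r' t * r (1 - t) - r t * r' (1 - t)) {t : ℝ} (ht : t ∈ Icc (0 : ℝ) (1 / 4)) :
    p' t = 2 * π * sin (4 * π * t) := by
  rw [hp', rampD_of_mem hr' ht, ramp_of_ge hr (t := 1 - t) (by linarith [ht.2]),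
    rampD_of_ge hr' (t := 1 - t) (by linarith [ht.2])]
  ring

/-- On `[1/4, 3/4]`: `p = 1`. [folklore] -/
theorem flatTop_of_mem_mid
    (hr : ∀ t, r t = 1 - (1 + cos (π * max 0 (min 1 ((t - 0) / (1 / 4))))) / 2)
    (hp : ∀ t, p t = r t * r (1 - t)) {t : ℝ} (ht : t ∈ Icc (1 / 4 : ℝ) (3 / 4)) : p t = 1 := by
  rw [hp, ramp_of_ge hr ht.1, ramp_of_ge hr (t := 1 - t) (by linarith [ht.2]), mul_one]

/-- On `[1/4, 3/4]`: `p' = 0`. [folklore] -/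
theorem flatTopDeriv_of_mem_mid
    (hr' : ∀ t, r' t = -(-(π / (1 / 4)) * sin (π * max 0 (min 1 ((t - 0) / (1 / 4)))) / 2))
    (hp' : ∀ t, p' t = r' t * r (1 - t) - r t * r' (1 - t)) {t : ℝ}
    (ht : t ∈ Icc (1 / 4 : ℝ) (3 / 4)) : p' t = 0 := by
  rw [hp', rampD_of_ge hr' ht.1, rampD_of_ge hr' (t := 1 - t) (by linarith [ht.2])]; ring

/-- On `[3/4, 1]`: `p(t) = (1 - cos 4π(1-t))/2`. [folklore] -/
theorem flatTop_of_mem_right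
    (hr : ∀ t, r t = 1 - (1 + cos (π * max 0 (min 1 ((t - 0) / (1 / 4))))) / 2)
    (hp : ∀ t, p t = r t * r (1 - t)) {t : ℝ} (ht : t ∈ Icc (3 / 4 : ℝ) 1) :
    p t = (1 - cos (4 * π * (1 - t))) / 2 := by
  rw [hp, ramp_of_ge hr (t := t) (by linarith [ht.1]),
    ramp_of_mem hr (t := 1 - t) ⟨by linarith [ht.2], by linarith [ht.1]⟩, one_mul]

/-- On `[3/4, 1]`: `p'(t) = -2π sin 4π(1-t)`. [folklore] -/
theorem flatTopDeriv_of_mem_right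
    (hr : ∀ t, r t = 1 - (1 + cos (π * max 0 (min 1 ((t - 0) / (1 / 4))))) / 2)
    (hr' : ∀ t, r' t = -(-(π / (1 / 4)) * sin (π * max 0 (min 1 ((t - 0) / (1 / 4)))) / 2))
    (hp' : ∀ t, p' t = r' t * r (1 - t) - r t * r' (1 - t)) {t : ℝ} (ht : t ∈ Icc (3 / 4 : ℝ) 1) :
    p' t = -(2 * π * sin (4 * π * (1 - t))) := by
  rw [hp', ramp_of_ge hr (t := t) (by linarith [ht.1]), rampD_of_ge hr' (t := t) (by linarith [ht.1]),
    rampD_of_mem hr' (t := 1 - t) ⟨by linarith [ht.2], by linarith [ht.1]⟩]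
  ring

/-! ### The constants `∫ p² = 11/16` and `∫ p'² = π²` -/

/-- **Mass of the flat-top profile**: `∫_ℝ p² = 3/32 + 1/2 + 3/32 = 11/16`. [folklore] -/
theorem integral_flatTop_sq
    (hr : ∀ t, r t = 1 - (1 + cos (π * max 0 (min 1 ((t - 0) / (1 / 4))))) / 2)
    (hp : ∀ t, p t = r t * r (1 - t)) : ∫ t, p t ^ 2 = 11 / 16 := by
  have hsupp : Function.support (fun t => p t ^ 2) ⊆ Ioc (0 : ℝ) 1 := by
    intro t ht
    have h : p t ≠ 0 := by simpa using ht
    by_contra hc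
    exact h (flatTop_eq_zero_of_not_mem hr hp t fun hm => hc (Ioo_subset_Ioc_self hm))
  have hi : ∀ a b : ℝ, IntervalIntegrable (fun t => p t ^ 2) volume a b := fun a b =>
    ((contDiff_flatTop hr hp).continuous.pow 2).intervalIntegrable a b
  rw [← integral_eq_integral_of_support_subset hsupp,
    ← integral_add_adjacent_intervals (hi 0 (1 / 4)) (hi (1 / 4) 1),
    ← integral_add_adjacent_intervals (hi (1 / 4) (3 / 4)) (hi (3 / 4) 1)]
  have h1 : ∫ t in (0 : ℝ)..(1 / 4), p t ^ 2 = 3 / 32 := by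
    rw [← integral_rampSq]
    refine integral_congr fun t ht => ?_
    rw [uIcc_of_le (by norm_num)] at ht
    simp only [flatTop_of_mem_left hr hp ht]
  have h2 : ∫ t in (1 / 4 : ℝ)..(3 / 4), p t ^ 2 = 1 / 2 := by
    rw [integral_congr (g := fun _ => (1 : ℝ)) fun t ht => ?_, intervalIntegral.integral_const]
    · norm_num
    · rw [uIcc_of_le (by norm_num)] at ht
      simp only [flatTop_of_mem_mid hr hp ht, one_pow]
  have h3 : ∫ t in (3 / 4 : ℝ)..1, p t ^ 2 = 3 / 32 := by
    rw [integral_congr (g := fun t => ((1 - cos (4 * π * (1 - t))) / 2) ^ 2) fun t ht => ?_]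
    · rw [intervalIntegral.integral_comp_sub_left (fun u : ℝ => ((1 - cos (4 * π * u)) / 2) ^ 2)
        (1 : ℝ) (a := 3 / 4) (b := 1), show (1 : ℝ) - 1 = 0 by norm_num,
        show (1 : ℝ) - 3 / 4 = 1 / 4 by norm_num, integral_rampSq]
    · rw [uIcc_of_le (by norm_num)] at ht
      simp only [flatTop_of_mem_right hr hp ht]
  rw [h1, h2, h3]; norm_num

/-- **Kinetic constant of the flat-top profile**: `∫_ℝ p'² = π²/2 + 0 + π²/2 = π²`.
[folklore] -/
theorem integral_flatTopDeriv_sq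
    (hr : ∀ t, r t = 1 - (1 + cos (π * max 0 (min 1 ((t - 0) / (1 / 4))))) / 2)
    (hr' : ∀ t, r' t = -(-(π / (1 / 4)) * sin (π * max 0 (min 1 ((t - 0) / (1 / 4)))) / 2))
    (hp' : ∀ t, p' t = r' t * r (1 - t) - r t * r' (1 - t)) : ∫ t, p' t ^ 2 = π ^ 2 := by
  have hsupp : Function.support (fun t => p' t ^ 2) ⊆ Ioc (0 : ℝ) 1 := by
    intro t ht
    have h : p' t ≠ 0 := by simpa using ht
    by_contra hc
    exact h (flatTopDeriv_eq_zero_of_not_mem hr hr' hp' fun hm => hc (Ioo_subset_Ioc_self hm))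
  have hi : ∀ a b : ℝ, IntervalIntegrable (fun t => p' t ^ 2) volume a b := fun a b =>
    ((continuous_flatTopDeriv hr hr' hp').pow 2).intervalIntegrable a b
  rw [← integral_eq_integral_of_support_subset hsupp,
    ← integral_add_adjacent_intervals (hi 0 (1 / 4)) (hi (1 / 4) 1),
    ← integral_add_adjacent_intervals (hi (1 / 4) (3 / 4)) (hi (3 / 4) 1)]
  have h1 : ∫ t in (0 : ℝ)..(1 / 4), p' t ^ 2 = π ^ 2 / 2 := by
    rw [← integral_rampDerivSq]
    refine integral_congr fun t ht => ?_
    rw [uIcc_of_le (by norm_num)] at ht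
    simp only [flatTopDeriv_of_mem_left hr hr' hp' ht]
  have h2 : ∫ t in (1 / 4 : ℝ)..(3 / 4), p' t ^ 2 = 0 := by
    rw [integral_congr (g := fun _ => (0 : ℝ)) fun t ht => ?_, intervalIntegral.integral_const,
      smul_zero]
    rw [uIcc_of_le (by norm_num)] at ht
    show p' t ^ 2 = 0
    rw [flatTopDeriv_of_mem_mid hr' hp' ht]; norm_num
  have h3 : ∫ t in (3 / 4 : ℝ)..1, p' t ^ 2 = π ^ 2 / 2 := by
    rw [integral_congr (g := fun t => (2 * π * sin (4 * π * (1 - t))) ^ 2) fun t ht => ?_]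
    · rw [intervalIntegral.integral_comp_sub_left (fun u : ℝ => (2 * π * sin (4 * π * u)) ^ 2)
        (1 : ℝ) (a := 3 / 4) (b := 1), show (1 : ℝ) - 1 = 0 by norm_num,
        show (1 : ℝ) - 3 / 4 = 1 / 4 by norm_num, integral_rampDerivSq]
    · rw [uIcc_of_le (by norm_num)] at ht
      simp only [flatTopDeriv_of_mem_right hr hr' hp' ht, neg_sq]
  rw [h1, h2, h3]; ring

/-! ### Integrability on the line -/

/-- `p²` is integrable on `ℝ` (continuous, supported in `[0, 1]`). [folklore] -/
theorem integrable_flatTop_sq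
    (hr : ∀ t, r t = 1 - (1 + cos (π * max 0 (min 1 ((t - 0) / (1 / 4))))) / 2)
    (hp : ∀ t, p t = r t * r (1 - t)) : Integrable fun t => p t ^ 2 := by
  refine ((contDiff_flatTop hr hp).continuous.pow 2).integrable_of_hasCompactSupport
    (HasCompactSupport.intro (isCompact_Icc (a := (0 : ℝ)) (b := 1)) fun t ht => ?_)
  have h : p t = 0 :=
    flatTop_eq_zero_of_not_mem hr hp t fun hm => ht (Ioo_subset_Icc_self hm)
  show p t ^ 2 = 0
  rw [h]; norm_num

/-- `p'²` is integrable on `ℝ`. [folklore] -/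
theorem integrable_flatTopDeriv_sq
    (hr : ∀ t, r t = 1 - (1 + cos (π * max 0 (min 1 ((t - 0) / (1 / 4))))) / 2)
    (hr' : ∀ t, r' t = -(-(π / (1 / 4)) * sin (π * max 0 (min 1 ((t - 0) / (1 / 4)))) / 2))
    (hp' : ∀ t, p' t = r' t * r (1 - t) - r t * r' (1 - t)) : Integrable fun t => p' t ^ 2 := by
  refine ((continuous_flatTopDeriv hr hr' hp').pow 2).integrable_of_hasCompactSupport
    (HasCompactSupport.intro (isCompact_Icc (a := (0 : ℝ)) (b := 1)) fun t ht => ?_)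
  have h : p' t = 0 :=
    flatTopDeriv_eq_zero_of_not_mem hr hr' hp' fun hm => ht (Ioo_subset_Icc_self hm)
  show p' t ^ 2 = 0
  rw [h]; norm_num

end Profile

/-- **The flat-top profile, packaged.** There are `b, b' : ℝ → ℝ` (namely
`b(t) = r(t)r(1-t)` with the cosine ramp `r` of width `1/4`, and its derivative) such that
`b'` is the derivative of `b` everywhere and is continuous, `0 ≤ b ≤ 1`, `b = 0` off `(0, 1)`,
`∫_ℝ b² = 11/16`, `∫_ℝ b'² = π²`, and `b²`, `b'²` are integrable. [folklore] -/
theorem exists_flatTopProfile :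
    ∃ b b' : ℝ → ℝ, (∀ t, HasDerivAt b (b' t) t) ∧ Continuous b' ∧
      (∀ t, 0 ≤ b t ∧ b t ≤ 1) ∧ (∀ t, t ∉ Ioo (0 : ℝ) 1 → b t = 0) ∧
      (∫ t, b t ^ 2 = 11 / 16) ∧ (∫ t, b' t ^ 2 = π ^ 2) ∧
      Integrable (fun t => b t ^ 2) ∧ Integrable (fun t => b' t ^ 2) := by
  set r : ℝ → ℝ := fun t => 1 - (1 + cos (π * max 0 (min 1 ((t - 0) / (1 / 4))))) / 2
    with hr_def
  have hr : ∀ t, r t = 1 - (1 + cos (π * max 0 (min 1 ((t - 0) / (1 / 4))))) / 2 :=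
    fun t => rfl
  set r' : ℝ → ℝ := fun t => -(-(π / (1 / 4)) * sin (π * max 0 (min 1 ((t - 0) / (1 / 4)))) / 2)
    with hr'_def
  have hr' : ∀ t, r' t = -(-(π / (1 / 4)) * sin (π * max 0 (min 1 ((t - 0) / (1 / 4)))) / 2) :=
    fun t => rfl
  set p : ℝ → ℝ := fun t => r t * r (1 - t) with hp_def
  have hp : ∀ t, p t = r t * r (1 - t) := fun t => rfl
  set p' : ℝ → ℝ := fun t => r' t * r (1 - t) - r t * r' (1 - t) with hp'_def
  have hp' : ∀ t, p' t = r' t * r (1 - t) - r t * r' (1 - t) := fun t => rfl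
  exact ⟨p, p', hasDerivAt_flatTop hr hr' hp hp', continuous_flatTopDeriv hr hr' hp',
    flatTop_mem hr hp, flatTop_eq_zero_of_not_mem hr hp, integral_flatTop_sq hr hp,
    integral_flatTopDeriv_sq hr hr' hp', integrable_flatTop_sq hr hp,
    integrable_flatTopDeriv_sq hr hr' hp'⟩

end FlatTop

end Literature.MathematicalPhysics.QuantumManyBody.BoseGas

end
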